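import Literature.Analysis.FunctionSpaces.PolchinskiExchangeIneq
import Literature.Analysis.FunctionSpaces.PolchinskiFluctuationHeat
import Literature.Analysis.FunctionSpaces.PolchinskiHeatEquation
import HarnessLib

/-!
# Continuity at `t = 0⁺` of `t ↦ E_{ν_t}[G_t]` for `G_t = Φ(P_{0,t}F)` and `G_t = (∇√P_{0,t}F)²_{Ċ_t}`
# (Bauerschmidt–Bodineau–Dagallier, proof of Theorem 3: the boundary values at `t = 0`)

Topic `Literature/Analysis/FunctionSpaces`; "proof architecture" file behind the named fact
`Polchinski.BauerschmidtBodineau_multiscaleBakryEmery` ([BBD] Theorem 3, `MultiscaleBakryEmery.lean`).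

[BBD] integrate the differential (in)equalities for `E_{ν_t}[Φ(P_{0,t}F)]` and `E_{ν_t}[(∇√P_{0,t}F)²_{Ċ_t}]`
from `t = 0`, where `ν_0 = ν₀`, `P_{0,0}F = F` (p0016 L47–90: «`Ent_{ν₀}(F) = …`», «`(∇√P_{0,0}F)²_{Ċ_0} =
(∇√F)²_{Ċ_0}`»).  In the tree the derivatives are available for `t > 0` (`PolchinskiExchangeIneq.lean`,
`PolchinskiEntropyDerivative.lean`), so the boundary values are attained as right limits; this file proves
them.  General principle (`tendsto_renormExpect_nhdsWithin_zero`): if `G_t → G₀` uniformly as `t → 0⁺` with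
`G₀` bounded uniformly continuous, then `E_{ν_t}[G_t] → E_{ν_0}[G₀]`; proof: `E_{ν_t}[G] = e^{V_∞(0)}
E_{C_∞−C_t}[Z_t G]` with `Z_t = E_{C_t}[e^{−V₀}(·+w)] → e^{−V₀}` uniformly (Gaussian smoothing,
`abs_integral_shift_sub_le`, `tr C_t → 0`) and `P_{C_∞−C_t} → P_{C_∞}` weakly on bounded uniformly continuous
functions (`tendsto_integral_gaussian_Cinf_sub_Ici`).  The two instances: the smoothed atoms
`E_{C_t}[Ψ(·+w)] → Ψ` uniformly for `Ψ ∈ C_b⁴`, hence `P_{0,t}F = W_t/Z_t → F`, `∂_kP_{0,t}F → ∂_kF` uniformly.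

## Main results (sorry-free; no new definitions, no new named facts)

* `unif_integral_shift` — `E_{C_t}[Ψ(y+w)] → Ψ(y)` uniformly in `y` as `t → 0⁺`;
* `tendsto_renormExpect_nhdsWithin_zero` — the general principle;
* **`tendsto_renormExpect_comp_semigroup_zero`** — `E_{ν_t}[Φ(P_{0,t}F)] → ∫ Φ(F) dν₀`;
* **`tendsto_renormExpect_sqrtEnergy_zero`** — `E_{ν_t}[(∇√P_{0,t}F)²_{Ċ_t}] → ∫ Σ Ċ_0^{kl}∂_kF∂_lF/(4F) dν₀`.

Nothing here concerns Yang–Mills.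

## References

* [BauerschmidtBodineauDagallier2023] R. Bauerschmidt, T. Bodineau, B. Dagallier, Probab. Surveys 21
  (2024) 200–290, arXiv:2307.07619 — Theorem 3 proof p0016 L47–90; Definition 2 (`ν_0 = ν₀`, `P_{t,t} = id`).
  READ (held text).
* [Rudin1976] W. Rudin, Principles of Mathematical Analysis — Thm 7.9–7.11 (uniform convergence algebra).
-/

noncomputable section

-- nested operator-norm instances `E →L[ℝ] E →L[ℝ] ℝ`
set_option maxSynthPendingDepth 3

open MeasureTheory ProbabilityTheory Filter Topology Set
open scoped RealInnerProductSpace Matrix MatrixOrder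

namespace Literature.Analysis.FunctionSpaces

namespace Polchinski

variable {N : ℕ}

/-! ### Helpers: algebra of uniform convergence along a filter -/

section Unif

variable {α : Type*} {l : Filter ℝ}

/-- A convergent scalar family is a uniformly convergent (constant-in-space) family. [folklore] -/
private theorem unif_scalar {c : ℝ → ℝ} {c0 : ℝ} (hc : Tendsto c l (𝓝 c0)) :
    ∀ ε : ℝ, 0 < ε → ∀ᶠ t in l, ∀ _y : α, |c t - c0| ≤ ε := by
  intro ε hε
  filter_upwards [Metric.tendsto_nhds.1 hc ε hε] with t ht y
  rw [Real.dist_eq] at ht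
  exact ht.le

/-- Uniform convergence: differences. [cite: Rudin1976, Thm 7.9] -/
private theorem unif_sub {A B : ℝ → α → ℝ} {A0 B0 : α → ℝ}
    (hA : ∀ ε : ℝ, 0 < ε → ∀ᶠ t in l, ∀ y, |A t y - A0 y| ≤ ε)
    (hB : ∀ ε : ℝ, 0 < ε → ∀ᶠ t in l, ∀ y, |B t y - B0 y| ≤ ε) :
    ∀ ε : ℝ, 0 < ε → ∀ᶠ t in l, ∀ y, |(A t y - B t y) - (A0 y - B0 y)| ≤ ε := by
  intro ε hε
  filter_upwards [hA (ε / 2) (half_pos hε), hB (ε / 2) (half_pos hε)] with t h1 h2 y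
  have he : (A t y - B t y) - (A0 y - B0 y) = (A t y - A0 y) - (B t y - B0 y) := by ring
  rw [he]
  exact (abs_sub _ _).trans (by linarith [h1 y, h2 y])

/-- Uniform convergence: products of bounded families. [cite: Rudin1976, Thm 7.9] -/
private theorem unif_mul {A B : ℝ → α → ℝ} {A0 B0 : α → ℝ} {KA KB : ℝ}
    (hA : ∀ ε : ℝ, 0 < ε → ∀ᶠ t in l, ∀ y, |A t y - A0 y| ≤ ε)
    (hB : ∀ ε : ℝ, 0 < ε → ∀ᶠ t in l, ∀ y, |B t y - B0 y| ≤ ε)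
    (bA : ∀ t y, |A t y| ≤ KA) (bB0 : ∀ y, |B0 y| ≤ KB) :
    ∀ ε : ℝ, 0 < ε → ∀ᶠ t in l, ∀ y, |A t y * B t y - A0 y * B0 y| ≤ ε := by
  intro ε hε
  filter_upwards [hA (ε / 2 / (|KB| + 1)) (by positivity), hB (ε / 2 / (|KA| + 1)) (by positivity)]
    with t h1 h2 y
  have he : A t y * B t y - A0 y * B0 y = A t y * (B t y - B0 y) + (A t y - A0 y) * B0 y := by ring
  rw [he]
  have hA' : |A t y| ≤ |KA| := (bA t y).trans (le_abs_self _)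
  have hB' : |B0 y| ≤ |KB| := (bB0 y).trans (le_abs_self _)
  calc |A t y * (B t y - B0 y) + (A t y - A0 y) * B0 y|
      ≤ |A t y| * |B t y - B0 y| + |A t y - A0 y| * |B0 y| := by
        refine (abs_add_le _ _).trans ?_
        rw [abs_mul, abs_mul]
    _ ≤ |KA| * (ε / 2 / (|KA| + 1)) + (ε / 2 / (|KB| + 1)) * |KB| :=
        add_le_add (mul_le_mul hA' (h2 y) (abs_nonneg _) (abs_nonneg _))
          (mul_le_mul (h1 y) hB' (abs_nonneg _) (by positivity))
    _ ≤ ε / 2 + ε / 2 := by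
        refine add_le_add ?_ ?_
        · rw [mul_div_assoc', div_le_iff₀ (by positivity)]
          nlinarith [abs_nonneg KA]
        · rw [div_mul_eq_mul_div, div_le_iff₀ (by positivity)]
          nlinarith [abs_nonneg KB]
    _ = ε := by ring

/-- Uniform convergence: inverses of families bounded below. [cite: Rudin1976, Thm 7.9] -/
private theorem unif_inv {A : ℝ → α → ℝ} {A0 : α → ℝ} {m : ℝ}
    (hA : ∀ ε : ℝ, 0 < ε → ∀ᶠ t in l, ∀ y, |A t y - A0 y| ≤ ε)
    (hm : 0 < m) (bA : ∀ t y, m ≤ A t y) (bA0 : ∀ y, m ≤ A0 y) :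
    ∀ ε : ℝ, 0 < ε → ∀ᶠ t in l, ∀ y, |(A t y)⁻¹ - (A0 y)⁻¹| ≤ ε := by
  intro ε hε
  filter_upwards [hA (ε * m ^ 2) (by positivity)] with t h1 y
  have hAt : 0 < A t y := hm.trans_le (bA t y)
  have hA0 : 0 < A0 y := hm.trans_le (bA0 y)
  rw [inv_sub_inv hAt.ne' hA0.ne', abs_div, abs_mul, abs_of_pos hAt, abs_of_pos hA0,
    div_le_iff₀ (mul_pos hAt hA0), abs_sub_comm]
  calc |A t y - A0 y| ≤ ε * m ^ 2 := h1 y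
    _ = ε * (m * m) := by ring
    _ ≤ ε * (A t y * A0 y) :=
        mul_le_mul_of_nonneg_left (mul_le_mul (bA t y) (bA0 y) hm.le hAt.le) hε.le

/-- Uniform convergence: finite sums. [cite: Rudin1976, Thm 7.9] -/
private theorem unif_sum {ι : Type*} (S : Finset ι) {A : ι → ℝ → α → ℝ} {A0 : ι → α → ℝ}
    (hA : ∀ i ∈ S, ∀ ε : ℝ, 0 < ε → ∀ᶠ t in l, ∀ y, |A i t y - A0 i y| ≤ ε) :
    ∀ ε : ℝ, 0 < ε → ∀ᶠ t in l, ∀ y, |(∑ i ∈ S, A i t y) - ∑ i ∈ S, A0 i y| ≤ ε := by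
  intro ε hε
  have hev : ∀ i ∈ S, ∀ᶠ t in l, ∀ y, |A i t y - A0 i y| ≤ ε / (S.card + 1) :=
    fun i hi => hA i hi _ (by positivity)
  filter_upwards [(Finset.eventually_all S).2 hev] with t ht y
  rw [← Finset.sum_sub_distrib]
  calc |∑ i ∈ S, (A i t y - A0 i y)| ≤ ∑ i ∈ S, |A i t y - A0 i y| := Finset.abs_sum_le_sum_abs _ _
    _ ≤ ∑ i ∈ S, ε / (S.card + 1) := Finset.sum_le_sum fun i hi => ht i hi y
    _ = S.card * (ε / (S.card + 1)) := by rw [Finset.sum_const, nsmul_eq_mul]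
    _ ≤ ε := by
        rw [mul_div_assoc', div_le_iff₀ (by positivity)]
        nlinarith

/-- Uniform convergence: composition with a uniformly continuous function. [cite: Rudin1976, Thm 7.9] -/
private theorem unif_comp {A : ℝ → α → ℝ} {A0 : α → ℝ} {Φ : ℝ → ℝ} (hΦ : UniformContinuous Φ)
    (hA : ∀ ε : ℝ, 0 < ε → ∀ᶠ t in l, ∀ y, |A t y - A0 y| ≤ ε) :
    ∀ ε : ℝ, 0 < ε → ∀ᶠ t in l, ∀ y, |Φ (A t y) - Φ (A0 y)| ≤ ε := by
  intro ε hε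
  obtain ⟨δ, hδ, hΦδ⟩ := Metric.uniformContinuous_iff.1 hΦ ε hε
  filter_upwards [hA (δ / 2) (half_pos hδ)] with t ht y
  have h : dist (A t y) (A0 y) < δ := by
    rw [Real.dist_eq]; linarith [ht y]
  have := hΦδ h
  rw [Real.dist_eq] at this
  exact this.le

end Unif

/-! ### Gaussian smoothing at small times: `E_{C_t}[Ψ(y+w)] → Ψ(y)` uniformly -/

section Atoms

variable (D : CovDecomposition N)

/-- **`E_{C_t}[Ψ(y+·)] → Ψ(y)` uniformly in `y` as `t → 0⁺`** for bounded uniformly continuous `Ψ`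
(`C_0 = 0`, `tr C_t → 0`). [cite: BauerschmidtBodineauDagallier2023, Proposition 8] -/
theorem unif_integral_shift {Ψ : EuclideanSpace ℝ (Fin N) → ℝ} (hΨm : Measurable Ψ) {M : ℝ}
    (hΨb : ∀ x, |Ψ x| ≤ M) (hΨu : UniformContinuous Ψ) :
    ∀ ε : ℝ, 0 < ε → ∀ᶠ t in 𝓝[Ici (0 : ℝ)] 0, ∀ y,
      |(∫ w, Ψ (y + w) ∂(multivariateGaussian 0 (D.C t))) - Ψ y| ≤ ε := by
  intro ε hε
  obtain ⟨δ, hδ, hUCδ⟩ := Metric.uniformContinuous_iff.1 hΨu (ε / 2) (half_pos hε)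
  have hUC' : ∀ x y : EuclideanSpace ℝ (Fin N), ‖x - y‖ < δ → |Ψ x - Ψ y| ≤ ε / 2 := fun x y h => by
    have := hUCδ (a := x) (b := y) (by rwa [dist_eq_norm])
    rw [Real.dist_eq] at this
    exact this.le
  have hM0 : 0 ≤ M := (abs_nonneg _).trans (hΨb 0)
  have htr : Tendsto (fun t => ∑ i, D.C t i i) (𝓝[Ici (0 : ℝ)] 0) (𝓝 0) := by
    have h : Tendsto (fun t => ∑ i, D.C t i i) (𝓝 0) (𝓝 (∑ i, D.C 0 i i)) :=
      tendsto_finsetSum _ fun i _ => (D.hasDerivAt_C 0 le_rfl i i).continuousAt.tendsto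
    rw [D.C_zero] at h
    simp only [Matrix.zero_apply, Finset.sum_const_zero] at h
    exact h.mono_left nhdsWithin_le_nhds
  have hev : ∀ᶠ t in 𝓝[Ici (0 : ℝ)] 0, 2 * M / δ ^ 2 * ∑ i, D.C t i i ≤ ε / 2 := by
    have h2 := (Metric.tendsto_nhds.1 htr) (ε / 2 / (2 * M / δ ^ 2 + 1)) (by positivity)
    filter_upwards [h2] with t ht
    rw [Real.dist_eq, sub_zero] at ht
    calc 2 * M / δ ^ 2 * ∑ i, D.C t i i ≤ (2 * M / δ ^ 2) * |∑ i, D.C t i i| :=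
          mul_le_mul_of_nonneg_left (le_abs_self _) (by positivity)
      _ ≤ (2 * M / δ ^ 2 + 1) * (ε / 2 / (2 * M / δ ^ 2 + 1)) :=
          mul_le_mul (by linarith) ht.le (abs_nonneg _) (by positivity)
      _ = ε / 2 := by field_simp
  filter_upwards [hev, self_mem_nhdsWithin] with t ht ht0 y
  have h := abs_integral_shift_sub_le hΨm hΨb hδ hUC' (D.posSemidef_C ht0) y
  linarith

/-- The same with the limit written as the `t = 0` member (`P_{C_0} = δ_0`).
[cite: BauerschmidtBodineauDagallier2023, Proposition 8] -/
theorem unif_integral_shift_zero {Ψ : EuclideanSpace ℝ (Fin N) → ℝ} (hΨm : Measurable Ψ) {M : ℝ}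
    (hΨb : ∀ x, |Ψ x| ≤ M) (hΨu : UniformContinuous Ψ) :
    ∀ ε : ℝ, 0 < ε → ∀ᶠ t in 𝓝[Ici (0 : ℝ)] 0, ∀ y,
      |(∫ w, Ψ (y + w) ∂(multivariateGaussian 0 (D.C t))) -
        ∫ w, Ψ (y + w) ∂(multivariateGaussian 0 (D.C 0))| ≤ ε := by
  intro ε hε
  filter_upwards [unif_integral_shift D hΨm hΨb hΨu ε hε] with t ht y
  rw [multivariateGaussian_C_zero D, integral_dirac, add_zero]
  exact ht y

/-- At `t = 0` the smoothed atom is the integrand: `E_{C_0}[Ψ(y+w)] = Ψ(y)`.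
[cite: BauerschmidtBodineauDagallier2023, Definition 2] -/
theorem integral_shift_C_zero (Ψ : EuclideanSpace ℝ (Fin N) → ℝ) (y : EuclideanSpace ℝ (Fin N)) :
    ∫ w, Ψ (y + w) ∂(multivariateGaussian 0 (D.C 0)) = Ψ y := by
  rw [multivariateGaussian_C_zero D, integral_dirac, add_zero]

end Atoms

/-! ### The general principle -/

section General

variable (D : CovDecomposition N) {V₀ : EuclideanSpace ℝ (Fin N) → ℝ}

/-- **Continuity of `t ↦ E_{ν_t}[G_t]` at `t = 0⁺`**: if `G_t → G₀` uniformly in space as `t → 0⁺`, each `G_t`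
is measurable and `G₀` is bounded and uniformly continuous, then `E_{ν_t}[G_t] → E_{ν_0}[G₀]`
(`V₀` bounded with `e^{−V₀}` uniformly continuous). [cite: BauerschmidtBodineauDagallier2023, Theorem 3 (proof)] -/
theorem tendsto_renormExpect_nhdsWithin_zero (hVm : Measurable V₀) {BV : ℝ} (hVabs : ∀ x, |V₀ x| ≤ BV)
    (hEu : UniformContinuous fun x => Real.exp (-V₀ x))
    {G : ℝ → EuclideanSpace ℝ (Fin N) → ℝ} {G0 : EuclideanSpace ℝ (Fin N) → ℝ}
    (hGm : ∀ t, Measurable (G t)) (hG0u : UniformContinuous G0) {K0 : ℝ} (hG0b : ∀ y, |G0 y| ≤ K0)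
    (hGu : ∀ ε : ℝ, 0 < ε → ∀ᶠ t in 𝓝[Ici (0 : ℝ)] 0, ∀ y, |G t y - G0 y| ≤ ε) :
    Tendsto (fun t => renormExpect D V₀ t (G t)) (𝓝[Ici (0 : ℝ)] 0) (𝓝 (renormExpect D V₀ 0 G0)) := by
  have hb : ∀ φ, -BV ≤ V₀ φ := fun φ => (abs_le.1 (hVabs φ)).1
  have hEb : ∀ x, |Real.exp (-V₀ x)| ≤ Real.exp BV := fun x => by
    rw [abs_of_pos (Real.exp_pos _), Real.exp_le_exp]
    exact (neg_le_abs _).trans (hVabs x)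
  have hEm : Measurable fun x => Real.exp (-V₀ x) := hVm.neg.exp
  have hK00 : 0 ≤ K0 := (abs_nonneg _).trans (hG0b 0)
  -- `Z_t → e^{−V₀}` uniformly, hence `Z_t G_t → e^{−V₀} G₀` uniformly
  have hZu := unif_integral_shift D hEm hEb hEu
  have hZb : ∀ t (y : EuclideanSpace ℝ (Fin N)),
      |∫ w, Real.exp (-V₀ (y + w)) ∂(multivariateGaussian 0 (D.C t))| ≤ Real.exp BV := fun t y => by
    have h := norm_integral_le_of_norm_le_const (μ := multivariateGaussian 0 (D.C t))
      (f := fun w => Real.exp (-V₀ (y + w))) (C := Real.exp BV)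
      (Eventually.of_forall fun w => by rw [Real.norm_eq_abs]; exact hEb (y + w))
    rwa [Real.norm_eq_abs, probReal_univ, mul_one] at h
  have hKu := unif_mul hZu hGu hZb hG0b
  -- weak continuity of `P_{C_∞−C_t}` on `e^{−V₀}G₀`
  have hK0u : UniformContinuous fun y => Real.exp (-V₀ y) * G0 y := uc_mul hEu hG0u hEb hG0b
  have hK0b : ∀ y, |Real.exp (-V₀ y) * G0 y| ≤ Real.exp BV * K0 := fun y => by
    rw [abs_mul]
    exact mul_le_mul (hEb y) (hG0b y) (abs_nonneg _) (Real.exp_pos _).le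
  have hK0m : Measurable fun y => Real.exp (-V₀ y) * G0 y := hEm.mul hG0u.continuous.measurable
  have hweak := tendsto_integral_gaussian_Cinf_sub_Ici D hK0m hK0b hK0u (t := 0) le_rfl 0
  simp only [zero_add] at hweak
  -- the expectation as an integral against `P_{C_∞−C_t}`
  unfold renormExpect
  simp only [renormPotential_zero]
  refine Tendsto.const_mul _ ?_
  rw [Metric.tendsto_nhds]
  intro ε hε
  have hε2 : 0 < ε / 2 := half_pos hε
  filter_upwards [hKu (ε / 2 / 2) (by positivity), Metric.tendsto_nhds.1 hweak (ε / 2) hε2]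
    with t ht1 ht2
  rw [Real.dist_eq] at ht2 ⊢
  -- pointwise control of the integrand
  have hpt : ∀ ζ, |Real.exp (-renormPotential D V₀ t ζ) * G t ζ - Real.exp (-V₀ ζ) * G0 ζ| ≤ ε / 2 / 2 :=
    fun ζ => by rw [exp_neg_renormPotential D hVm hb t ζ]; exact ht1 ζ
  have hI0 : Integrable (fun ζ => Real.exp (-V₀ ζ) * G0 ζ) (multivariateGaussian 0 (D.Cinf - D.C t)) :=
    Integrable.of_bound hK0m.aestronglyMeasurable (Real.exp BV * K0)
      (Eventually.of_forall fun ζ => by rw [Real.norm_eq_abs]; exact hK0b ζ)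
  have hIt : Integrable (fun ζ => Real.exp (-renormPotential D V₀ t ζ) * G t ζ)
      (multivariateGaussian 0 (D.Cinf - D.C t)) :=
    Integrable.of_bound (measurable_exp_neg_renormPotential_mul D hVm t (hGm t)).aestronglyMeasurable
      (Real.exp BV * K0 + ε / 2 / 2) (Eventually.of_forall fun ζ => by
        rw [Real.norm_eq_abs]
        have h1 := hpt ζ
        have h2 := hK0b ζ
        have h3 := abs_sub_abs_le_abs_sub (Real.exp (-renormPotential D V₀ t ζ) * G t ζ)
          (Real.exp (-V₀ ζ) * G0 ζ)
        linarith)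
  have hA : |(∫ ζ, Real.exp (-renormPotential D V₀ t ζ) * G t ζ ∂(multivariateGaussian 0 (D.Cinf - D.C t))) -
      ∫ ζ, Real.exp (-V₀ ζ) * G0 ζ ∂(multivariateGaussian 0 (D.Cinf - D.C t))| ≤ ε / 2 / 2 := by
    rw [← integral_sub hIt hI0]
    have h := norm_integral_le_of_norm_le_const (μ := multivariateGaussian 0 (D.Cinf - D.C t))
      (f := fun ζ => Real.exp (-renormPotential D V₀ t ζ) * G t ζ - Real.exp (-V₀ ζ) * G0 ζ)
      (C := ε / 2 / 2) (Eventually.of_forall fun ζ => by rw [Real.norm_eq_abs]; exact hpt ζ)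
    rwa [Real.norm_eq_abs, probReal_univ, mul_one] at h
  have htri := abs_sub_le
    (∫ ζ, Real.exp (-renormPotential D V₀ t ζ) * G t ζ ∂(multivariateGaussian 0 (D.Cinf - D.C t)))
    (∫ ζ, Real.exp (-V₀ ζ) * G0 ζ ∂(multivariateGaussian 0 (D.Cinf - D.C t)))
    (∫ ζ, Real.exp (-V₀ ζ) * G0 ζ ∂(multivariateGaussian 0 (D.Cinf - D.C 0)))
  linarith

end General

/-! ### The two instances: `Φ(P_{0,t}F)` and `(∇√P_{0,t}F)²_{Ċ_t}` -/

section Instances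

variable (D : CovDecomposition N) {V₀ F : EuclideanSpace ℝ (Fin N) → ℝ} {BV BF a b : ℝ}

/-- Data of a `C_b⁴` integrand's partial `x ↦ ∂_kΨ(x)`: measurable, bounded by `B`, uniformly continuous.
[cite: BauerschmidtBodineauDagallier2023, Theorem 3 (proof)] -/
private theorem partial_data {Ψ : EuclideanSpace ℝ (Fin N) → ℝ} {B : ℝ} (hΨ : ContDiff ℝ 4 Ψ)
    (hB : ∀ n ≤ 4, ∀ x, ‖iteratedFDeriv ℝ n Ψ x‖ ≤ B) (k : Fin N) :
    Measurable (fun x => fderiv ℝ Ψ x (EuclideanSpace.single k 1)) ∧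
    (∀ x, |fderiv ℝ Ψ x (EuclideanSpace.single k 1)| ≤ B) ∧
    UniformContinuous (fun x => fderiv ℝ Ψ x (EuclideanSpace.single k 1)) := by
  refine ⟨((ContinuousLinearMap.apply ℝ ℝ (EuclideanSpace.single k 1)).continuous.comp
      (atom_continuous hΨ hB).2.1).measurable, fun x => ?_,
    (ContinuousLinearMap.apply ℝ ℝ (EuclideanSpace.single k 1)).uniformContinuous.comp
      (atom_uniformContinuous hΨ hB).2⟩
  have h := Cb4.abs_partial_le hB (EuclideanSpace.single k 1) x
  rwa [Cb4.norm_single_one, mul_one] at h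

/-- **`E_{ν_t}[Φ(P_{0,t}F)] → ∫ Φ(F) dν₀` as `t → 0⁺`** (`ν_0 = ν₀`, `P_{0,0} = id`; [BBD] proof of Theorem 3,
the value `Ent` is attained at `t = 0`), for `V₀, F ∈ C⁴` with bounded derivatives and `Φ` bounded and
uniformly continuous. [cite: BauerschmidtBodineauDagallier2023, Theorem 3 (proof)] -/
theorem tendsto_renormExpect_comp_semigroup_zero
    (hV : ContDiff ℝ 4 V₀) (hVB : ∀ n ≤ 4, ∀ x, ‖iteratedFDeriv ℝ n V₀ x‖ ≤ BV)
    (hF : ContDiff ℝ 4 F) (hFB : ∀ n ≤ 4, ∀ x, ‖iteratedFDeriv ℝ n F x‖ ≤ BF)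
    {Φ : ℝ → ℝ} (hΦu : UniformContinuous Φ) {P0 : ℝ} (hP0 : ∀ x, |Φ x| ≤ P0) :
    Tendsto (fun t => renormExpect D V₀ t fun y => Φ (semigroup D V₀ 0 t F y)) (𝓝[Ici (0 : ℝ)] 0)
      (𝓝 (∫ φ, Φ (F φ) ∂(nu0 D V₀))) := by
  obtain ⟨hΨZ, hBZ⟩ := Cb4.exp_neg hV hVB
  obtain ⟨hΨW, hBW⟩ := Cb4.mul hΨZ hF hBZ hFB
  have hVc : Continuous V₀ := hV.continuous
  have hVabs : ∀ x, |V₀ x| ≤ BV := Cb4.abs_le hVB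
  have hb : ∀ φ, -BV ≤ V₀ φ := fun φ => (abs_le.1 (hVabs φ)).1
  have hVm : Measurable V₀ := hVc.measurable
  have hm : (0 : ℝ) < Real.exp (-BV) := Real.exp_pos _
  have hEu : UniformContinuous fun x => Real.exp (-V₀ x) := (atom_uniformContinuous hΨZ hBZ).1
  have pZ := fun s => sm_pack hΨZ hBZ (multivariateGaussian 0 (D.C s))
  have pW := fun s => sm_pack hΨW hBW (multivariateGaussian 0 (D.C s))
  have hmZ : ∀ s y, Real.exp (-BV) ≤
      ∫ ζ, Real.exp (-V₀ (y + ζ)) ∂(multivariateGaussian 0 (D.C s)) :=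
    fun s y => exp_neg_le_integral_exp_neg hVc hVabs _ y
  have hsemi : ∀ s y, semigroup D V₀ 0 s F y =
      (∫ ζ, Real.exp (-V₀ (y + ζ)) * F (y + ζ) ∂(multivariateGaussian 0 (D.C s))) *
        (∫ ζ, Real.exp (-V₀ (y + ζ)) ∂(multivariateGaussian 0 (D.C s)))⁻¹ := fun s y => by
    rw [semigroup_zero_eq, exp_renormPotential_eq_inv D hVm hb, mul_comm]
  -- uniform convergence of the atoms and of `u_t`
  have uZ := unif_integral_shift_zero D hΨZ.continuous.measurable (Cb4.abs_le hBZ) hEu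
  have uW := unif_integral_shift_zero D hΨW.continuous.measurable (Cb4.abs_le hBW)
    (atom_uniformContinuous hΨW hBW).1
  have uIZ := unif_inv uZ hm hmZ (hmZ 0)
  have bIZ0 : ∀ y, |(∫ ζ, Real.exp (-V₀ (y + ζ)) ∂(multivariateGaussian 0 (D.C 0)))⁻¹| ≤
      (Real.exp (-BV))⁻¹ := fun y => by
    rw [abs_inv, abs_of_pos (hm.trans_le (hmZ 0 y))]
    exact inv_anti₀ hm (hmZ 0 y)
  have uu := unif_mul uW uIZ (fun s y => (pW s).2.2.1 y) bIZ0
  have uG := unif_comp hΦu uu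
  -- the general principle
  have hFu : UniformContinuous F := (atom_uniformContinuous hF hFB).1
  have hcu : ∀ t, Continuous (semigroup D V₀ 0 t F) := fun t => by
    have he : semigroup D V₀ 0 t F = fun y =>
        (∫ ζ, Real.exp (-V₀ (y + ζ)) * F (y + ζ) ∂(multivariateGaussian 0 (D.C t))) *
          (∫ ζ, Real.exp (-V₀ (y + ζ)) ∂(multivariateGaussian 0 (D.C t)))⁻¹ := funext (hsemi t)
    rw [he]
    exact (continuous_iff_continuousAt.2 fun y => ((pW t).1 y).continuousAt).mul
      ((continuous_iff_continuousAt.2 fun y => ((pZ t).1 y).continuousAt).inv₀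
        fun y => (hm.trans_le (hmZ t y)).ne')
  have h := tendsto_renormExpect_nhdsWithin_zero D hVm hVabs hEu
    (G := fun t y => Φ (semigroup D V₀ 0 t F y)) (G0 := fun y => Φ (F y))
    (fun t => (hΦu.continuous.comp (hcu t)).measurable)
    (hΦu.comp hFu) (fun y => hP0 (F y))
    (fun ε hε => by
      filter_upwards [uG ε hε] with t ht y
      have h := ht y
      rwa [← hsemi t y, ← hsemi 0 y, semigroup_self] at h)
  rwa [renormExpect_zero D hVm hb] at h

set_option maxHeartbeats 800000 in
/-- **`E_{ν_t}[(∇√P_{0,t}F)²_{Ċ_t}] → E_{ν₀}[(∇√F)²_{Ċ_0}] = ∫ Σ Ċ_0^{kl}∂_kF∂_lF/(4F) dν₀` as `t → 0⁺`**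
([BBD] proof of Theorem 3: the right-hand side of (e:LSI) is the value at `t = 0`), for `V₀, F ∈ C⁴` with
bounded derivatives and `0 < a ≤ F ≤ b` (`Ċ` read at `t ∨ 0`). [cite: BauerschmidtBodineauDagallier2023, Theorem 3 (proof)] -/
theorem tendsto_renormExpect_sqrtEnergy_zero
    (hV : ContDiff ℝ 4 V₀) (hVB : ∀ n ≤ 4, ∀ x, ‖iteratedFDeriv ℝ n V₀ x‖ ≤ BV)
    (hF : ContDiff ℝ 4 F) (hFB : ∀ n ≤ 4, ∀ x, ‖iteratedFDeriv ℝ n F x‖ ≤ BF)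
    (ha : 0 < a) (hab : ∀ x, a ≤ F x ∧ F x ≤ b) :
    Tendsto (fun t => renormExpect D V₀ t fun y =>
        (1 / 4) * ((∑ k, ∑ l, D.Cdot (max t 0) k l *
          (fderiv ℝ (semigroup D V₀ 0 t F) y (EuclideanSpace.single k 1) *
            fderiv ℝ (semigroup D V₀ 0 t F) y (EuclideanSpace.single l 1))) *
          (semigroup D V₀ 0 t F y)⁻¹)) (𝓝[Ici (0 : ℝ)] 0)
      (𝓝 (∫ φ, (1 / 4) * ((∑ k, ∑ l, D.Cdot 0 k l *
          (fderiv ℝ F φ (EuclideanSpace.single k 1) * fderiv ℝ F φ (EuclideanSpace.single l 1))) *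
          (F φ)⁻¹) ∂(nu0 D V₀))) := by
  classical
  obtain ⟨hΨZ, hBZ⟩ := Cb4.exp_neg hV hVB
  obtain ⟨hΨW, hBW⟩ := Cb4.mul hΨZ hF hBZ hFB
  have hVc : Continuous V₀ := hV.continuous
  have hFc : Continuous F := hF.continuous
  have hVabs : ∀ x, |V₀ x| ≤ BV := Cb4.abs_le hVB
  have hb : ∀ φ, -BV ≤ V₀ φ := fun φ => (abs_le.1 (hVabs φ)).1
  have hVm : Measurable V₀ := hVc.measurable
  have hm : (0 : ℝ) < Real.exp (-BV) := Real.exp_pos _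
  have hBZ0 : (0 : ℝ) ≤ 24 * Real.exp BV * max BV 1 ^ 4 := by positivity
  have hBF0 : 0 ≤ BF := le_trans (norm_nonneg _) (hFB 0 (by norm_num) 0)
  have hEu : UniformContinuous fun x => Real.exp (-V₀ x) := (atom_uniformContinuous hΨZ hBZ).1
  obtain ⟨KC, hKC⟩ := D.bounded_Cdot
  have pZ := fun s => sm_pack hΨZ hBZ (multivariateGaussian 0 (D.C s))
  have pW := fun s => sm_pack hΨW hBW (multivariateGaussian 0 (D.C s))
  have dZ1 := fun k => partial_data hΨZ hBZ k
  have dW1 := fun k => partial_data hΨW hBW k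
  have hZ1 := fun s k x =>
    sm_fderiv_apply hΨZ hBZ (multivariateGaussian 0 (D.C s)) x (EuclideanSpace.single k 1)
  have hW1 := fun s k x =>
    sm_fderiv_apply hΨW hBW (multivariateGaussian 0 (D.C s)) x (EuclideanSpace.single k 1)
  have hmZ : ∀ s y, Real.exp (-BV) ≤
      ∫ ζ, Real.exp (-V₀ (y + ζ)) ∂(multivariateGaussian 0 (D.C s)) :=
    fun s y => exp_neg_le_integral_exp_neg hVc hVabs _ y
  have hZpos : ∀ s y, 0 < ∫ ζ, Real.exp (-V₀ (y + ζ)) ∂(multivariateGaussian 0 (D.C s)) :=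
    fun s y => hm.trans_le (hmZ s y)
  have haW : ∀ s y, a * (∫ ζ, Real.exp (-V₀ (y + ζ)) ∂(multivariateGaussian 0 (D.C s))) ≤
      ∫ ζ, Real.exp (-V₀ (y + ζ)) * F (y + ζ) ∂(multivariateGaussian 0 (D.C s)) :=
    fun s y => (integral_exp_neg_mul_mem hVc hVabs hFc hab _ y).1
  have hsemi : ∀ s y, semigroup D V₀ 0 s F y =
      (∫ ζ, Real.exp (-V₀ (y + ζ)) * F (y + ζ) ∂(multivariateGaussian 0 (D.C s))) *
        (∫ ζ, Real.exp (-V₀ (y + ζ)) ∂(multivariateGaussian 0 (D.C s)))⁻¹ := fun s y => by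
    rw [semigroup_zero_eq, exp_renormPotential_eq_inv D hVm hb, mul_comm]
  have hau : ∀ s y, a ≤ (∫ ζ, Real.exp (-V₀ (y + ζ)) * F (y + ζ) ∂(multivariateGaussian 0 (D.C s))) *
      (∫ ζ, Real.exp (-V₀ (y + ζ)) ∂(multivariateGaussian 0 (D.C s)))⁻¹ := fun s y => by
    rw [← div_eq_mul_inv, le_div_iff₀ (hZpos s y)]
    exact haW s y
  have hgf : ∀ k s y, fderiv ℝ (semigroup D V₀ 0 s F) y (EuclideanSpace.single k 1) =
      (∫ ζ, fderiv ℝ (fun x => Real.exp (-V₀ x) * F x) (y + ζ) (EuclideanSpace.single k 1)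
          ∂(multivariateGaussian 0 (D.C s))) *
        (∫ ζ, Real.exp (-V₀ (y + ζ)) ∂(multivariateGaussian 0 (D.C s)))⁻¹ -
      (∫ ζ, Real.exp (-V₀ (y + ζ)) * F (y + ζ) ∂(multivariateGaussian 0 (D.C s))) *
        ((∫ ζ, fderiv ℝ (fun x => Real.exp (-V₀ x)) (y + ζ) (EuclideanSpace.single k 1)
            ∂(multivariateGaussian 0 (D.C s))) *
          ((∫ ζ, Real.exp (-V₀ (y + ζ)) ∂(multivariateGaussian 0 (D.C s)))⁻¹ *
            (∫ ζ, Real.exp (-V₀ (y + ζ)) ∂(multivariateGaussian 0 (D.C s)))⁻¹)) := by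
    intro k s y
    obtain ⟨Du, D2u, K1u, K2u, pu, hDu, -⟩ :=
      quotient_jets (pZ s) (pW s) hm (hmZ s) (semigroup D V₀ 0 s F) (hsemi s)
    rw [(pu.1 y).fderiv, hDu, hZ1 s, hW1 s]
    ring
  ---------------------------------------------------------------- uniform convergence of the atoms
  have uZ := unif_integral_shift_zero D hΨZ.continuous.measurable (Cb4.abs_le hBZ) hEu
  have uW := unif_integral_shift_zero D hΨW.continuous.measurable (Cb4.abs_le hBW)
    (atom_uniformContinuous hΨW hBW).1
  have uZ1 := fun k => unif_integral_shift_zero D (dZ1 k).1 (dZ1 k).2.1 (dZ1 k).2.2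
  have uW1 := fun k => unif_integral_shift_zero D (dW1 k).1 (dW1 k).2.1 (dW1 k).2.2
  -- bounds of the atoms (all `t`) and of the limits
  have bW : ∀ s y, |∫ ζ, Real.exp (-V₀ (y + ζ)) * F (y + ζ) ∂(multivariateGaussian 0 (D.C s))| ≤
      16 * (24 * Real.exp BV * max BV 1 ^ 4) * BF := fun s y => (pW s).2.2.1 y
  have bZ1 : ∀ k s y, |∫ ζ, fderiv ℝ (fun x => Real.exp (-V₀ x)) (y + ζ) (EuclideanSpace.single k 1)
      ∂(multivariateGaussian 0 (D.C s))| ≤ 24 * Real.exp BV * max BV 1 ^ 4 := fun k s y => by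
    have h := sm_partial_abs_le hBZ (multivariateGaussian 0 (D.C s)) (EuclideanSpace.single k 1) y
    rwa [Cb4.norm_single_one, mul_one] at h
  have bW1 : ∀ k s y, |∫ ζ, fderiv ℝ (fun x => Real.exp (-V₀ x) * F x) (y + ζ) (EuclideanSpace.single k 1)
      ∂(multivariateGaussian 0 (D.C s))| ≤ 16 * (24 * Real.exp BV * max BV 1 ^ 4) * BF := fun k s y => by
    have h := sm_partial_abs_le hBW (multivariateGaussian 0 (D.C s)) (EuclideanSpace.single k 1) y
    rwa [Cb4.norm_single_one, mul_one] at h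
  have bIZ : ∀ s y, |(∫ ζ, Real.exp (-V₀ (y + ζ)) ∂(multivariateGaussian 0 (D.C s)))⁻¹| ≤
      (Real.exp (-BV))⁻¹ := fun s y => by
    rw [abs_inv, abs_of_pos (hZpos s y)]
    exact inv_anti₀ hm (hmZ s y)
  have bIZ2 : ∀ s y, |(∫ ζ, Real.exp (-V₀ (y + ζ)) ∂(multivariateGaussian 0 (D.C s)))⁻¹ *
      (∫ ζ, Real.exp (-V₀ (y + ζ)) ∂(multivariateGaussian 0 (D.C s)))⁻¹| ≤
      (Real.exp (-BV))⁻¹ * (Real.exp (-BV))⁻¹ := fun s y => by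
    rw [abs_mul]
    exact mul_le_mul (bIZ s y) (bIZ s y) (abs_nonneg _) (by positivity)
  ---------------------------------------------------------------- `u_t`, `g_{k,t}`, `A_t`, `G_t`
  have uIZ := unif_inv uZ hm hmZ (hmZ 0)
  have uIZ2 := unif_mul uIZ uIZ bIZ (bIZ 0)
  have uu := unif_mul uW uIZ bW (bIZ 0)
  have uIU := unif_inv uu ha hau (hau 0)
  set Kg : ℝ := 16 * (24 * Real.exp BV * max BV 1 ^ 4) * BF * (Real.exp (-BV))⁻¹ +
    16 * (24 * Real.exp BV * max BV 1 ^ 4) * BF * (24 * Real.exp BV * max BV 1 ^ 4 *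
      ((Real.exp (-BV))⁻¹ * (Real.exp (-BV))⁻¹)) with hKg
  have bg : ∀ k s y, |(∫ ζ, fderiv ℝ (fun x => Real.exp (-V₀ x) * F x) (y + ζ) (EuclideanSpace.single k 1)
          ∂(multivariateGaussian 0 (D.C s))) *
        (∫ ζ, Real.exp (-V₀ (y + ζ)) ∂(multivariateGaussian 0 (D.C s)))⁻¹ -
      (∫ ζ, Real.exp (-V₀ (y + ζ)) * F (y + ζ) ∂(multivariateGaussian 0 (D.C s))) *
        ((∫ ζ, fderiv ℝ (fun x => Real.exp (-V₀ x)) (y + ζ) (EuclideanSpace.single k 1)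
            ∂(multivariateGaussian 0 (D.C s))) *
          ((∫ ζ, Real.exp (-V₀ (y + ζ)) ∂(multivariateGaussian 0 (D.C s)))⁻¹ *
            (∫ ζ, Real.exp (-V₀ (y + ζ)) ∂(multivariateGaussian 0 (D.C s)))⁻¹))| ≤ Kg := by
    intro k s y
    refine (abs_sub _ _).trans (add_le_add ?_ ?_)
    · rw [abs_mul]
      exact mul_le_mul (bW1 k s y) (bIZ s y) (abs_nonneg _) (by positivity)
    · rw [abs_mul, abs_mul]
      exact mul_le_mul (bW s y) (mul_le_mul (bZ1 k s y) (bIZ2 s y) (abs_nonneg _) hBZ0)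
        (by positivity) (by positivity)
  have ug := fun k => unif_sub (unif_mul (uW1 k) uIZ (bW1 k) (bIZ 0))
    (unif_mul uW (unif_mul (uZ1 k) uIZ2 (bZ1 k) (bIZ2 0)) bW (fun y => by
      rw [abs_mul]
      exact mul_le_mul (bZ1 k 0 y) (bIZ2 0 y) (abs_nonneg _) hBZ0))
  have hC0 : ∀ k l, Tendsto (fun t : ℝ => D.Cdot (max t 0) k l) (𝓝[Ici (0 : ℝ)] 0) (𝓝 (D.Cdot 0 k l)) :=
    fun k l => tendsto_nhdsWithin_congr (f := fun t => D.Cdot t k l)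
      (fun t ht => by rw [max_eq_left (mem_Ici.1 ht)])
      (((D.hasDerivAt_Cdot 0 le_rfl k l).continuousAt.tendsto).mono_left nhdsWithin_le_nhds)
  have bC : ∀ (t : ℝ) k l, |D.Cdot (max t 0) k l| ≤ KC := fun t k l => hKC _ (le_max_right _ _) k l
  have hKg0 : 0 ≤ Kg := by positivity
  set GG : Fin N → ℝ → EuclideanSpace ℝ (Fin N) → ℝ := fun k s y =>
    (∫ ζ, fderiv ℝ (fun x => Real.exp (-V₀ x) * F x) (y + ζ) (EuclideanSpace.single k 1)
        ∂(multivariateGaussian 0 (D.C s))) *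
      (∫ ζ, Real.exp (-V₀ (y + ζ)) ∂(multivariateGaussian 0 (D.C s)))⁻¹ -
    (∫ ζ, Real.exp (-V₀ (y + ζ)) * F (y + ζ) ∂(multivariateGaussian 0 (D.C s))) *
      ((∫ ζ, fderiv ℝ (fun x => Real.exp (-V₀ x)) (y + ζ) (EuclideanSpace.single k 1)
          ∂(multivariateGaussian 0 (D.C s))) *
        ((∫ ζ, Real.exp (-V₀ (y + ζ)) ∂(multivariateGaussian 0 (D.C s)))⁻¹ *
          (∫ ζ, Real.exp (-V₀ (y + ζ)) ∂(multivariateGaussian 0 (D.C s)))⁻¹)) with hGG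

  have uA := unif_sum (l := 𝓝[Ici (0 : ℝ)] 0) (α := EuclideanSpace ℝ (Fin N)) Finset.univ
    (A := fun k t y => ∑ l, D.Cdot (max t 0) k l * (GG k t y * GG l t y))
    (A0 := fun k y => ∑ l, D.Cdot 0 k l * (GG k 0 y * GG l 0 y))
    fun k _ => unif_sum Finset.univ
      (A := fun l t y => D.Cdot (max t 0) k l * (GG k t y * GG l t y))
      (A0 := fun l y => D.Cdot 0 k l * (GG k 0 y * GG l 0 y))
      fun l _ => unif_mul (unif_scalar (hC0 k l)) (unif_mul (ug k) (ug l) (bg k) (bg l 0))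
        (fun t _ => bC t k l) (fun y => by
          rw [abs_mul]; exact mul_le_mul (bg k 0 y) (bg l 0 y) (abs_nonneg _) hKg0)
  have bA' : ∀ (M : Matrix (Fin N) (Fin N) ℝ), (∀ k l, |M k l| ≤ KC) → ∀ t y,
      |∑ k, ∑ l, M k l * (GG k t y * GG l t y)| ≤ ∑ _k : Fin N, ∑ _l : Fin N, KC * (Kg * Kg) :=
    fun M hM t y =>
    (Finset.abs_sum_le_sum_abs _ _).trans (Finset.sum_le_sum fun k _ =>
      (Finset.abs_sum_le_sum_abs _ _).trans (Finset.sum_le_sum fun l _ => by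
        rw [abs_mul, abs_mul]
        exact mul_le_mul (hM k l) (mul_le_mul (bg k t y) (bg l t y) (abs_nonneg _) hKg0)
          (by positivity) ((abs_nonneg _).trans (hM k l))))
  have bA : ∀ t y, |∑ k, ∑ l, D.Cdot (max t 0) k l * (GG k t y * GG l t y)| ≤
      ∑ _k : Fin N, ∑ _l : Fin N, KC * (Kg * Kg) := fun t y => bA' _ (bC t) t y
  have bA0 : ∀ y, |∑ k, ∑ l, D.Cdot 0 k l * (GG k 0 y * GG l 0 y)| ≤
      ∑ _k : Fin N, ∑ _l : Fin N, KC * (Kg * Kg) := fun y => bA' _ (hKC 0 le_rfl) 0 y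
  have bIU0 : ∀ y, |((∫ ζ, Real.exp (-V₀ (y + ζ)) * F (y + ζ) ∂(multivariateGaussian 0 (D.C 0))) *
      (∫ ζ, Real.exp (-V₀ (y + ζ)) ∂(multivariateGaussian 0 (D.C 0)))⁻¹)⁻¹| ≤ a⁻¹ := fun y => by
    rw [abs_inv, abs_of_pos (ha.trans_le (hau 0 y))]
    exact inv_anti₀ ha (hau 0 y)
  have uAU := unif_mul uA uIU bA bIU0
  have uG := unif_mul (unif_scalar (α := EuclideanSpace ℝ (Fin N))
    (tendsto_const_nhds (x := (1 / 4 : ℝ)) (f := 𝓝[Ici (0 : ℝ)] 0))) uAU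
    (KA := |(1 / 4 : ℝ)|) (fun _ _ => le_rfl)
    (KB := (∑ _k : Fin N, ∑ _l : Fin N, KC * (Kg * Kg)) * a⁻¹) (fun y => by
      rw [abs_mul]
      exact mul_le_mul (bA0 y) (bIU0 y) (abs_nonneg _)
        ((abs_nonneg _).trans (bA0 y)))
  ---------------------------------------------------------------- the value at `t = 0`
  have h00 : semigroup D V₀ 0 0 F = F := funext fun y => semigroup_self D 0 F y
  have hΓ0 : ∀ y, (1 / 4) * ((∑ k, ∑ l, D.Cdot 0 k l * (GG k 0 y * GG l 0 y)) *
      ((∫ ζ, Real.exp (-V₀ (y + ζ)) * F (y + ζ) ∂(multivariateGaussian 0 (D.C 0))) *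
        (∫ ζ, Real.exp (-V₀ (y + ζ)) ∂(multivariateGaussian 0 (D.C 0)))⁻¹)⁻¹) =
      (1 / 4) * ((∑ k, ∑ l, D.Cdot 0 k l *
        (fderiv ℝ F y (EuclideanSpace.single k 1) * fderiv ℝ F y (EuclideanSpace.single l 1))) *
        (F y)⁻¹) := by
    intro y
    simp only [hGG, ← hgf, ← hsemi, h00]
  -- regularity of the limit
  have hFu : UniformContinuous F := (atom_uniformContinuous hF hFB).1
  have hFb : ∀ x, |F x| ≤ BF := Cb4.abs_le hFB
  have haF : ∀ x, a ≤ F x := fun x => (hab x).1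
  have hdF : ∀ k, UniformContinuous (fun y => fderiv ℝ F y (EuclideanSpace.single k 1)) ∧
      ∀ y, |fderiv ℝ F y (EuclideanSpace.single k 1)| ≤ BF := fun k => by
    obtain ⟨-, hb', hu'⟩ := partial_data hF hFB k
    exact ⟨hu', hb'⟩
  have hIFu : UniformContinuous fun y => (F y)⁻¹ := uc_inv hFu ha haF
  have hIFb : ∀ y, |(F y)⁻¹| ≤ a⁻¹ := fun y => by
    rw [abs_inv, abs_of_pos (ha.trans_le (haF y))]; exact inv_anti₀ ha (haF y)
  have hSu : UniformContinuous fun y => ∑ k, ∑ l, D.Cdot 0 k l *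
      (fderiv ℝ F y (EuclideanSpace.single k 1) * fderiv ℝ F y (EuclideanSpace.single l 1)) :=
    uc_finset_sum Finset.univ _ fun k _ => uc_finset_sum Finset.univ _ fun l _ =>
      uc_mul uniformContinuous_const (uc_mul (hdF k).1 (hdF l).1 (hdF k).2 (hdF l).2)
        (fun _ => le_rfl) (B := BF * BF) fun y => by
          rw [abs_mul]; exact mul_le_mul ((hdF k).2 y) ((hdF l).2 y) (abs_nonneg _) hBF0
  have hSb : ∀ y, |∑ k, ∑ l, D.Cdot 0 k l *
      (fderiv ℝ F y (EuclideanSpace.single k 1) * fderiv ℝ F y (EuclideanSpace.single l 1))| ≤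
      ∑ k : Fin N, ∑ l : Fin N, |D.Cdot 0 k l| * (BF * BF) := fun y =>
    (Finset.abs_sum_le_sum_abs _ _).trans (Finset.sum_le_sum fun k _ =>
      (Finset.abs_sum_le_sum_abs _ _).trans (Finset.sum_le_sum fun l _ => by
        rw [abs_mul, abs_mul]
        exact mul_le_mul_of_nonneg_left (mul_le_mul ((hdF k).2 y) ((hdF l).2 y) (abs_nonneg _) hBF0)
          (abs_nonneg _)))
  have hG0u : UniformContinuous fun y => (1 / 4) * ((∑ k, ∑ l, D.Cdot 0 k l *
      (fderiv ℝ F y (EuclideanSpace.single k 1) * fderiv ℝ F y (EuclideanSpace.single l 1))) *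
      (F y)⁻¹) :=
    uc_mul uniformContinuous_const (uc_mul hSu hIFu hSb hIFb) (fun _ => le_rfl)
      (B := (∑ k : Fin N, ∑ l : Fin N, |D.Cdot 0 k l| * (BF * BF)) * a⁻¹) fun y => by
        rw [abs_mul]
        exact mul_le_mul (hSb y) (hIFb y) (abs_nonneg _) ((abs_nonneg _).trans (hSb y))
  have hG0b : ∀ y, |(1 / 4) * ((∑ k, ∑ l, D.Cdot 0 k l *
      (fderiv ℝ F y (EuclideanSpace.single k 1) * fderiv ℝ F y (EuclideanSpace.single l 1))) *
      (F y)⁻¹)| ≤ |(1 / 4 : ℝ)| * ((∑ k : Fin N, ∑ l : Fin N, |D.Cdot 0 k l| * (BF * BF)) * a⁻¹) :=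
    fun y => by
      rw [abs_mul, abs_mul]
      exact mul_le_mul_of_nonneg_left (mul_le_mul (hSb y) (hIFb y) (abs_nonneg _)
        ((abs_nonneg _).trans (hSb y))) (abs_nonneg _)
  ---------------------------------------------------------------- measurability of `G_t`
  have cZ : ∀ s, Continuous fun y => ∫ ζ, Real.exp (-V₀ (y + ζ)) ∂(multivariateGaussian 0 (D.C s)) :=
    fun s => continuous_iff_continuousAt.2 fun y => ((pZ s).1 y).continuousAt
  have cW : ∀ s, Continuous fun y =>
      ∫ ζ, Real.exp (-V₀ (y + ζ)) * F (y + ζ) ∂(multivariateGaussian 0 (D.C s)) :=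
    fun s => continuous_iff_continuousAt.2 fun y => ((pW s).1 y).continuousAt
  have cZ1 : ∀ k s, Continuous fun y => ∫ ζ, fderiv ℝ (fun x => Real.exp (-V₀ x)) (y + ζ)
      (EuclideanSpace.single k 1) ∂(multivariateGaussian 0 (D.C s)) := fun k s =>
    continuous_iff_continuousAt.2 fun y =>
      ((sm_partial_pack hΨZ hBZ (multivariateGaussian 0 (D.C s)) (EuclideanSpace.single k 1)).1
        y).continuousAt
  have cW1 : ∀ k s, Continuous fun y => ∫ ζ, fderiv ℝ (fun x => Real.exp (-V₀ x) * F x) (y + ζ)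
      (EuclideanSpace.single k 1) ∂(multivariateGaussian 0 (D.C s)) := fun k s =>
    continuous_iff_continuousAt.2 fun y =>
      ((sm_partial_pack hΨW hBW (multivariateGaussian 0 (D.C s)) (EuclideanSpace.single k 1)).1
        y).continuousAt
  have cIZ : ∀ s, Continuous fun y =>
      (∫ ζ, Real.exp (-V₀ (y + ζ)) ∂(multivariateGaussian 0 (D.C s)))⁻¹ :=
    fun s => (cZ s).inv₀ fun y => (hZpos s y).ne'
  have cGG : ∀ k s, Continuous (GG k s) := fun k s => by
    simp only [hGG]
    exact ((cW1 k s).mul (cIZ s)).sub ((cW s).mul ((cZ1 k s).mul ((cIZ s).mul (cIZ s))))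
  have hGm : ∀ t, Measurable fun y => (1 / 4) * ((∑ k, ∑ l, D.Cdot (max t 0) k l *
      (fderiv ℝ (semigroup D V₀ 0 t F) y (EuclideanSpace.single k 1) *
        fderiv ℝ (semigroup D V₀ 0 t F) y (EuclideanSpace.single l 1))) *
      (semigroup D V₀ 0 t F y)⁻¹) := by
    intro t
    have he : (fun y => (1 / 4) * ((∑ k, ∑ l, D.Cdot (max t 0) k l *
        (fderiv ℝ (semigroup D V₀ 0 t F) y (EuclideanSpace.single k 1) *
          fderiv ℝ (semigroup D V₀ 0 t F) y (EuclideanSpace.single l 1))) *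
        (semigroup D V₀ 0 t F y)⁻¹)) = fun y => (1 / 4) * ((∑ k, ∑ l, D.Cdot (max t 0) k l *
        (GG k t y * GG l t y)) *
        ((∫ ζ, Real.exp (-V₀ (y + ζ)) * F (y + ζ) ∂(multivariateGaussian 0 (D.C t))) *
          (∫ ζ, Real.exp (-V₀ (y + ζ)) ∂(multivariateGaussian 0 (D.C t)))⁻¹)⁻¹) := by
      funext y
      simp only [hGG, ← hgf, ← hsemi]
    rw [he]
    refine (continuous_const.mul ((continuous_finsetSum _ fun k _ => continuous_finsetSum _
      fun l _ => continuous_const.mul ((cGG k t).mul (cGG l t))).mul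
        (((cW t).mul (cIZ t)).inv₀ fun y => (ha.trans_le (hau t y)).ne'))).measurable
  ---------------------------------------------------------------- conclusion
  have h := tendsto_renormExpect_nhdsWithin_zero D hVm hVabs hEu
    (G := fun t y => (1 / 4) * ((∑ k, ∑ l, D.Cdot (max t 0) k l *
      (fderiv ℝ (semigroup D V₀ 0 t F) y (EuclideanSpace.single k 1) *
        fderiv ℝ (semigroup D V₀ 0 t F) y (EuclideanSpace.single l 1))) *
      (semigroup D V₀ 0 t F y)⁻¹))
    (G0 := fun y => (1 / 4) * ((∑ k, ∑ l, D.Cdot 0 k l *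
      (fderiv ℝ F y (EuclideanSpace.single k 1) * fderiv ℝ F y (EuclideanSpace.single l 1))) *
      (F y)⁻¹)) hGm hG0u hG0b
    (fun ε hε => by
      filter_upwards [uG ε hε] with t ht y
      have h := ht y
      simp only [hGG, ← hgf, ← hsemi, h00] at h
      exact h)
  rwa [renormExpect_zero D hVm hb] at h

end Instances

end Polchinski

end Literature.Analysis.FunctionSpaces

end
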